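import Literature.MathematicalPhysics.KineticTheory.HarmonicChaosDecomposition
import HarnessLib

/-!
# The algebraic Wick theorem in a free commutative algebra (helper part `Algebra` of
`wickCovariance_of_stein`, stub K2 `stub_wickShellStatic`, line `gram-pencil-harmonic-chaos`, crux
`EmbeddedDrudeMourre.DrudeDissolution`, item stmt-AtomisticToContinuum-12593; `--supports` file, closes nothing)

WHAT. Janson's derivation proof of Wick's theorem (Gaussian Hilbert Spaces, Thm 3.9 with the recursion
Thm 3.15), carried out ABSTRACTLY in the free commutative `ℝ`-algebra `R = MvPolynomial α ℝ` on a set `α` of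
symbols with a "covariance" `C : α → α → ℝ` (no symmetry of `C` is used):
* WICK POLYNOMIALS `W N f ∈ R` (`f : Fin N → α`): `W 0 = 1`, `W 1 f = X_{f 0}`,
  `W (N+2) f = X_{f 0} W (N+1) (tail f) − Σ_i C(f 0, f (i+1)) W N (tail f minus i)` (`exists_wickPoly`);
* CONTRACTION DERIVATIONS `∂_h` of `R`, `∂_h X_g = C(h, g)` (`exists_contractionDeriv`), the Leibniz rule on
  products of generators (`contractionDeriv_prod_X`) and the WICK DERIVATIVE RULE
  `∂_h W (N+1) f = Σ_i C(h, f i) W N (f minus i)` (`contractionDeriv_wickPoly`; the double-contraction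
  terms cancel by the pair-swap symmetry `sum_sum_removeNth_comm`);
* for a linear functional `Λ : R → ℝ` satisfying STEIN'S IDENTITY `Λ (X_h p) = Λ (∂_h p)`:
  `Λ (W (N+1) f · q) = Λ (W N (tail f) · ∂_{f 0} q)` (`func_wickPoly_succ_mul`), hence `Λ (W (N+1) f) = 0`,
  `Λ (W N f · W M g) = 0` for `N ≠ M`, and, if `Λ 1 = 1`, the permanent formula
  `Λ (W N f · W N g) = Σ_{π ∈ S_N} Π_i C(f i, g (π i))` (`func_wickPoly_mul_self`, by induction with the
  row expansion `sum_perm_fin_succ_expand` of `Σ_π Π_i A i (π i)`).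
The companion file `…WickCovariance.lean` applies this with `α = TestFn`, `C = thermalCov ω₂ T`,
`X_h ↦ linObs h` and `Λ = ∫ · dμ`.

References: S. Janson, Gaussian Hilbert Spaces (1997), Thms 3.9, 3.15. [cite: Janson1997, Thm 3.9]
-/

noncomputable section

namespace Summit.AtomisticToContinuum.FouriersLaw.Theorems.DrudeDissolution.GramPencilHarmonicChaos

open MeasureTheory Filter Set Function Topology
open scoped InnerProductSpace ENNReal ComplexConjugate
open Literature.MathematicalPhysics.KineticTheory
open Literature.MathematicalPhysics.KineticTheory.HeatConduction
open HarmonicChaos ProbabilityTheory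

/-! ### §1. Tuple and permutation bookkeeping -/

/-- Removing the entry `i.succ` from `Fin.cons a g` is `Fin.cons a` of `g` with `i` removed. [folklore] -/
theorem removeNth_succ_cons {α : Type*} {n : ℕ} (a : α) (g : Fin (n + 1) → α) (i : Fin (n + 1)) :
    (Fin.removeNth i.succ (Fin.cons a g : Fin (n + 2) → α) : Fin (n + 1) → α) =
      Fin.cons a (Fin.removeNth i g : Fin n → α) := by
  ext l
  induction l using Fin.cases with
  | zero => simp [Fin.removeNth_apply]
  | succ l => simp [Fin.removeNth_apply, Fin.succ_succAbove_succ]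

/-- Pair-swap symmetry of the double sum over ordered pairs of removed entries: removing `j` and then
`i` (entries `g j`, `g (j.succAbove i)`) ranges over the same ordered pairs, with the same remainders,
as with the two roles exchanged. [folklore] -/
theorem sum_sum_removeNth_comm {M : Type*} [AddCommMonoid M] {α : Type*} {n : ℕ}
    (g : Fin (n + 2) → α) (φ : α → α → (Fin n → α) → M) :
    ∑ j : Fin (n + 2), ∑ i : Fin (n + 1),
        φ (g j) (g (j.succAbove i)) (Fin.removeNth i (Fin.removeNth j g)) =
      ∑ j : Fin (n + 2), ∑ i : Fin (n + 1),
        φ (g (j.succAbove i)) (g j) (Fin.removeNth i (Fin.removeNth j g)) := by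
  rw [← Fintype.sum_prod_type', ← Fintype.sum_prod_type']
  set τ : Fin (n + 2) × Fin (n + 1) → Fin (n + 2) × Fin (n + 1) :=
    fun p => (p.1.succAbove p.2, p.2.predAbove p.1) with hτ
  have hinv : Function.Involutive τ := by
    rintro ⟨j, i⟩
    simp [τ, Fin.succAbove_succAbove_predAbove, Fin.predAbove_predAbove_succAbove]
  calc ∑ p : Fin (n + 2) × Fin (n + 1),
        φ (g p.1) (g (p.1.succAbove p.2)) (Fin.removeNth p.2 (Fin.removeNth p.1 g))
      = ∑ p : Fin (n + 2) × Fin (n + 1), φ (g (τ p).1) (g ((τ p).1.succAbove (τ p).2))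
          (Fin.removeNth (τ p).2 (Fin.removeNth (τ p).1 g)) :=
        (hinv.bijective.sum_comp (fun p : Fin (n + 2) × Fin (n + 1) =>
          φ (g p.1) (g (p.1.succAbove p.2)) (Fin.removeNth p.2 (Fin.removeNth p.1 g)))).symm
    _ = _ := by
        refine Fintype.sum_congr _ _ fun p => ?_
        simp only [τ, Fin.succAbove_succAbove_predAbove, ← Fin.removeNth_removeNth_eq_swap]

/-- **Row expansion of the permanent-type sum** `Σ_π Π_i A i (π i)` along the row `0`:
`Σ_π Π_i A i (π i) = Σ_j A 0 j · Σ_{π'} Π_i A (i+1) (j.succAbove (π' i))`. [folklore] -/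
theorem sum_perm_fin_succ_expand :
    ∀ {n : ℕ} (A : Fin (n + 1) → Fin (n + 1) → ℝ),
      ∑ π : Equiv.Perm (Fin (n + 1)), ∏ i, A i (π i) =
        ∑ j : Fin (n + 1), A 0 j *
          ∑ e : Equiv.Perm (Fin n), ∏ i : Fin n, A i.succ (j.succAbove (e i)) := by
  intro n A
  set ρ : Fin (n + 1) × Equiv.Perm (Fin n) → Equiv.Perm (Fin (n + 1)) :=
    fun je => je.1.cycleRange.symm * Equiv.Perm.decomposeFin.symm (0, je.2) with hρ
  have hρ0 : ∀ j e, ρ (j, e) 0 = j := by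
    intro j e; simp [ρ, Equiv.Perm.mul_apply]
  have hρs : ∀ j e (i : Fin n), ρ (j, e) i.succ = j.succAbove (e i) := by
    intro j e i; simp [ρ, Equiv.Perm.mul_apply]
  have hbij : Function.Bijective ρ := by
    rw [Fintype.bijective_iff_injective_and_card]
    refine ⟨?_, by simp [Fintype.card_perm, Nat.factorial_succ]⟩
    rintro ⟨j, e⟩ ⟨j', e'⟩ h
    have hj : j = j' := by rw [← hρ0 j e, ← hρ0 j' e', h]
    subst hj
    simp only [Prod.mk.injEq, true_and]
    ext i
    have h2 : ρ (j, e) i.succ = ρ (j, e') i.succ := by rw [h]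
    rw [hρs, hρs] at h2
    exact congrArg Fin.val (Fin.succAbove_right_injective h2)
  rw [← hbij.sum_comp (fun π : Equiv.Perm (Fin (n + 1)) => ∏ i, A i (π i)), Fintype.sum_prod_type]
  refine Finset.sum_congr rfl fun j _ => ?_
  rw [Finset.mul_sum]
  refine Finset.sum_congr rfl fun e _ => ?_
  simp only [Fin.prod_univ_succ, hρ0, hρs]

/-! ### §2. Wick polynomials and contraction derivations of the free commutative algebra -/

section WickAlgebra

variable {α : Type*} {C : α → α → ℝ}
  {W : (N : ℕ) → (Fin N → α) → MvPolynomial α ℝ}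
  {D : α → Derivation ℝ (MvPolynomial α ℝ) (MvPolynomial α ℝ)}
  {Λ : MvPolynomial α ℝ →ₗ[ℝ] ℝ}

variable (C) in
/-- **Existence of the Wick polynomials** `W N f ∈ MvPolynomial α ℝ` defined by Janson's recursion
`W 0 = 1`, `W 1 f = X_{f 0}`, `W (N+2) f = X_{f 0} · W (N+1) (tail f) − Σ_i C(f 0, f (i+1)) · W N (tail f minus i)`.
[cite: Janson1997, Thm 3.15] -/
theorem exists_wickPoly :
    ∃ W : (N : ℕ) → (Fin N → α) → MvPolynomial α ℝ,
      (∀ f, W 0 f = 1) ∧ (∀ f, W 1 f = MvPolynomial.X (f 0)) ∧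
        ∀ (N : ℕ) (f : Fin (N + 2) → α), W (N + 2) f =
          MvPolynomial.X (f 0) * W (N + 1) (Fin.tail f) -
            ∑ i, C (f 0) (f i.succ) • W N (Fin.removeNth i (Fin.tail f)) := by
  let V : (N : ℕ) →
      ((Fin N → α) → MvPolynomial α ℝ) × ((Fin (N + 1) → α) → MvPolynomial α ℝ) :=
    fun N => Nat.rec
      (motive := fun N => ((Fin N → α) → MvPolynomial α ℝ) × ((Fin (N + 1) → α) → MvPolynomial α ℝ))
      (fun _ => 1, fun f => MvPolynomial.X (f 0))
      (fun _ V => (V.2, fun f => MvPolynomial.X (f 0) * V.2 (Fin.tail f) -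
        ∑ i, C (f 0) (f i.succ) • V.1 (Fin.removeNth i (Fin.tail f)))) N
  exact ⟨fun N => (V N).1, fun _ => rfl, fun _ => rfl, fun _ _ => rfl⟩

variable (C) in
/-- **Existence of the contraction derivations** `∂_h` of `MvPolynomial α ℝ` with `∂_h X_g = C(h, g)`. [folklore] -/
theorem exists_contractionDeriv :
    ∃ D : α → Derivation ℝ (MvPolynomial α ℝ) (MvPolynomial α ℝ),
      ∀ h g, D h (MvPolynomial.X g) = C h g • (1 : MvPolynomial α ℝ) :=
  ⟨fun h => MvPolynomial.mkDerivation ℝ fun g => C h g • (1 : MvPolynomial α ℝ),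
    fun h g => by simp [MvPolynomial.mkDerivation_X]⟩

variable
  (hW : (∀ f, W 0 f = 1) ∧ (∀ f, W 1 f = MvPolynomial.X (f 0)) ∧
    ∀ (N : ℕ) (f : Fin (N + 2) → α), W (N + 2) f =
      MvPolynomial.X (f 0) * W (N + 1) (Fin.tail f) -
        ∑ i, C (f 0) (f i.succ) • W N (Fin.removeNth i (Fin.tail f)))
  (hD : ∀ h g, D h (MvPolynomial.X g) = C h g • (1 : MvPolynomial α ℝ))
  (hX : ∀ (h : α) (p : MvPolynomial α ℝ), Λ (MvPolynomial.X h * p) = Λ (D h p))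

include hW in
/-- The Wick recursion on a tuple `Fin.cons a g` of length `≥ 2`. [cite: Janson1997, Thm 3.15] -/
theorem wickPoly_cons_succ (N : ℕ) (a : α) (g : Fin (N + 1) → α) :
    W (N + 2) (Fin.cons a g) =
      MvPolynomial.X a * W (N + 1) g - ∑ i, C a (g i) • W N (Fin.removeNth i g) := by
  rw [hW.2.2]
  simp only [Fin.cons_zero, Fin.tail_cons, Fin.cons_succ]

include hD in
/-- Leibniz rule on a product of generators:
`∂_h Π_j X_{G j} = Σ_j C(h, G j) Π_{l ≠ j} X_{G l}`. [folklore] -/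
theorem contractionDeriv_prod_X (h : α) : ∀ (k : ℕ) (G : Fin (k + 1) → α),
    D h (∏ j, MvPolynomial.X (G j)) = ∑ j, C h (G j) • ∏ l, MvPolynomial.X (Fin.removeNth j G l)
  | 0, G => by
      simp [Fin.removeNth_apply, hD]
  | k + 1, G => by
      have e1 : ∀ j : Fin (k + 1),
          ∏ l : Fin (k + 1), (MvPolynomial.X (Fin.removeNth j.succ G l) : MvPolynomial α ℝ) =
            MvPolynomial.X (G 0) *
              ∏ l : Fin k, MvPolynomial.X (Fin.removeNth j (fun i => G i.succ) l) := by
        intro j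
        rw [Fin.prod_univ_succ]
        simp [Fin.removeNth_apply, Fin.succ_succAbove_succ]
      have e2 : ∏ l : Fin (k + 1), (MvPolynomial.X (Fin.removeNth 0 G l) : MvPolynomial α ℝ) =
          ∏ j : Fin (k + 1), MvPolynomial.X (G j.succ) := by
        simp [Fin.removeNth_apply]
      rw [Fin.prod_univ_succ, Derivation.leibniz, contractionDeriv_prod_X h k (fun j => G j.succ), hD]
      conv_rhs => rw [Fin.sum_univ_succ]
      simp only [e1, e2, smul_eq_mul, mul_smul_comm, mul_one, Finset.mul_sum]
      rw [add_comm]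

include hW hD in
/-- **The Wick derivative rule** `∂_h W (N+1) f = Σ_i C(h, f i) · W N (f minus i)`. [cite: Janson1997, Thm 3.15] -/
theorem contractionDeriv_wickPoly (h : α) : ∀ (N : ℕ) (f : Fin (N + 1) → α),
    D h (W (N + 1) f) = ∑ i, C h (f i) • W N (Fin.removeNth i f)
  | 0, f => by
      rw [hW.2.1, hD]
      simp [hW.1]
  | 1, f => by
      obtain ⟨a, g, rfl⟩ : ∃ (a : α) (g : Fin 1 → α), f = Fin.cons a g :=
        ⟨f 0, Fin.tail f, (Fin.cons_self_tail f).symm⟩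
      rw [wickPoly_cons_succ hW]
      conv_rhs => rw [Fin.sum_univ_succ]
      simp only [Fin.cons_zero, Fin.cons_succ, Fin.removeNth_zero, Fin.tail_cons, removeNth_succ_cons,
        map_sub, map_sum, Derivation.map_smul, Derivation.leibniz, contractionDeriv_wickPoly h 0, hD,
        smul_eq_mul]
      simp [hW.1, hW.2.1, MvPolynomial.smul_eq_C_mul]
      ring
  | N + 2, f => by
      obtain ⟨a, g, rfl⟩ : ∃ (a : α) (g : Fin (N + 2) → α), f = Fin.cons a g :=
        ⟨f 0, Fin.tail f, (Fin.cons_self_tail f).symm⟩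
      rw [wickPoly_cons_succ hW]
      conv_rhs => rw [Fin.sum_univ_succ]
      simp only [Fin.cons_zero, Fin.cons_succ, Fin.removeNth_zero, Fin.tail_cons, removeNth_succ_cons,
        map_sub, map_sum, Derivation.map_smul, Derivation.leibniz, contractionDeriv_wickPoly h (N + 1) g,
        contractionDeriv_wickPoly h N, hD, smul_eq_mul, wickPoly_cons_succ hW]
      have e3 : ∑ i : Fin (N + 2), C a (g i) •
            ∑ l : Fin (N + 1), C h (Fin.removeNth i g l) • W N (Fin.removeNth l (Fin.removeNth i g)) =
          ∑ i : Fin (N + 2), C h (g i) •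
            ∑ l : Fin (N + 1), C a (Fin.removeNth i g l) • W N (Fin.removeNth l (Fin.removeNth i g)) := by
        simp only [Finset.smul_sum, smul_smul, Fin.removeNth_apply]
        rw [sum_sum_removeNth_comm g (fun x y r => (C a x * C h y) • W N r)]
        refine Finset.sum_congr rfl fun i _ => Finset.sum_congr rfl fun l _ => ?_
        rw [mul_comm]
      rw [e3, Finset.mul_sum]
      simp only [smul_sub, Finset.sum_sub_distrib, mul_smul_comm, mul_one]
      abel

/-! ### §3. Consequences of Stein's identity for a linear functional -/

include hW hD hX in
/-- **Peeling one Wick factor**: if `Λ (X_h p) = Λ (∂_h p)` for all `h, p` (Stein's identity), then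
`Λ (W (N+1) f · q) = Λ (W N (tail f) · ∂_{f 0} q)` (Leibniz and the Wick derivative rule cancel the
contraction terms). [cite: Janson1997, Thm 3.9] -/
theorem func_wickPoly_succ_mul (N : ℕ) (f : Fin (N + 1) → α) (q : MvPolynomial α ℝ) :
    Λ (W (N + 1) f * q) = Λ (W N (Fin.tail f) * D (f 0) q) := by
  cases N with
  | zero => rw [hW.2.1, hW.1, one_mul, hX]
  | succ N =>
      have hDW : D (f 0) (W (N + 1) (Fin.tail f)) =
          ∑ i : Fin (N + 1), C (f 0) (f i.succ) • W N (Fin.removeNth i (Fin.tail f)) :=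
        contractionDeriv_wickPoly hW hD (f 0) N (Fin.tail f)
      rw [hW.2.2, sub_mul, map_sub, mul_assoc, hX, Derivation.leibniz, smul_eq_mul, smul_eq_mul, map_add,
        hDW, mul_comm q, add_sub_cancel_right]

include hW hD hX in
/-- `Λ (W (N+1) f) = 0`: Wick polynomials of positive degree are `Λ`-centred. [cite: Janson1997, Thm 3.9] -/
theorem func_wickPoly_succ (N : ℕ) (f : Fin (N + 1) → α) : Λ (W (N + 1) f) = 0 := by
  have := func_wickPoly_succ_mul hW hD hX N f 1
  rwa [mul_one, Derivation.map_one_eq_zero, mul_zero, map_zero] at this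

include hW hD hX in
/-- Orthogonality of Wick polynomials of different degrees: `Λ (W N f · W M g) = 0` for `N ≠ M`.
[cite: Janson1997, Thm 3.9] -/
theorem func_wickPoly_mul_of_ne :
    ∀ (N M : ℕ) (f : Fin N → α) (g : Fin M → α), N ≠ M → Λ (W N f * W M g) = 0
  | 0, 0, _, _, h => (h rfl).elim
  | 0, M + 1, f, g, _ => by
      rw [hW.1, one_mul]
      exact func_wickPoly_succ hW hD hX M g
  | N + 1, 0, f, g, _ => by
      rw [func_wickPoly_succ_mul hW hD hX, hW.1, Derivation.map_one_eq_zero, mul_zero, map_zero]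
  | N + 1, M + 1, f, g, h => by
      rw [func_wickPoly_succ_mul hW hD hX, contractionDeriv_wickPoly hW hD, Finset.mul_sum, map_sum]
      refine Finset.sum_eq_zero fun j _ => ?_
      rw [mul_smul_comm, map_smul, func_wickPoly_mul_of_ne N M _ _ (fun e => h (by rw [e])), smul_zero]

include hW hD hX in
/-- **The permanent formula** `Λ (W N f · W N g) = Σ_{π ∈ S_N} Π_i C(f i, g (π i))` (for `Λ 1 = 1`).
[cite: Janson1997, Thm 3.9] -/
theorem func_wickPoly_mul_self (hΛ : Λ 1 = 1) : ∀ (N : ℕ) (f g : Fin N → α),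
    Λ (W N f * W N g) = ∑ π : Equiv.Perm (Fin N), ∏ i, C (f i) (g (π i))
  | 0, f, g => by
      rw [hW.1, hW.1, one_mul, hΛ]
      simp
  | N + 1, f, g => by
      rw [func_wickPoly_succ_mul hW hD hX, contractionDeriv_wickPoly hW hD, Finset.mul_sum, map_sum,
        sum_perm_fin_succ_expand (fun i j => C (f i) (g j))]
      refine Finset.sum_congr rfl fun j _ => ?_
      rw [mul_smul_comm, map_smul, func_wickPoly_mul_self hΛ N, smul_eq_mul]
      rfl

end WickAlgebra

end Summit.AtomisticToContinuum.FouriersLaw.Theorems.DrudeDissolution.GramPencilHarmonicChaos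

end
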